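import Literature.NumberTheory.Automorphic.SquareIntegrableInvariantForm                     -- ★ p853654 row 70 (F) `Representation.selfExtension_splits_of_memLp_matrixCoeff`
import Literature.NumberTheory.Rogawski1990.U3PrincipalSeriesReducibility                      -- ★ `IrrClass.IsSquareIntegrable`
import Summits.HodgeConjecture.HodgeConjecture.Theorems.F0P3cStCharTSScTracePackage            -- ★ `isAdmissible_smoothIrrep`, `nonarchimedeanGroup_Gqs` (brings ★ `Gqs`, `isCompact_center_Gqs`)
import Literature.NumberTheory.Automorphic.LocalUnitaryGroupUnimodularIsotropic                 -- ★ `isMulRightInvariant_cmDatum_local_antidiagOne` (`U(Φ₃)(L⁺_v)` unimodular)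
import Literature.NumberTheory.Automorphic.SquareIntegrableModCompactCenter                     -- ★ p853649 71-d `Representation.memLp_matrixCoeff_of_forall_isSquareIntegrableModCenter`
import Summits.HodgeConjecture.HodgeConjecture.Theorems.F0P3cStCharTSSelfExtSquareIntegrable     -- ★ p853685 71-D `isSquareIntegrableModCenter_of_selfExtension` (LH6-p04 (g12))
import HarnessLib

/-!
# (S5) — `hsplit` OF ★ 59-F AT EVERY `L²` CLASS: smooth self-extensions of a square-integrable irreducible of `U(Φ₃)(L⁺_v)` split

Cell `pub/hodgecm-mathlib`, crux H413 = `stmt-HodgeConjecture-24833` (`--supports … --as helper`, THEOREMS ONLY: no definition ∕ instance ∕ notation ∕ named fact ∕ `sorry`).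
Namespace `Summit.HodgeConjecture.HodgeConjecture.Cruxes.H413.F0P3cStCharTSHsplitOfL2`.  E1 BRICK LEDGER (keeper F0P3a-p03 (g31) k25∕k35) «(S5) DOCKING» of the
«PAYDOWN-L² ROAD FOR K2′» (LEAD F0P3a-plan (g16) T15-54 (A); MEMO F0P2-p06 (g23) d721df4f): the binder `hsplit` of ★ 59-F
`Theorems/F0P3cStCharTSEPNormOneUnr.innerG_char_self_eq_one_of_isPseudoCoeff_epThree` (:109–111) —
«every SMOOTH self-extension `0 → r.ρ —i→ ρE —p→ r.ρ → 0` splits» — PROVED for every irreducible `r` of `G = Gqs L v = U(Φ₃)(L⁺_v)` (non-split `v`) whose class is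
SQUARE-INTEGRABLE modulo the (compact) centre (`(IrrClass.mk r).IsSquareIntegrable μZ`, the organ's `𝔇.IsL2 ⟦r⟧`), from:
* ★ row 70 (F) `Representation.selfExtension_splits_of_memLp_matrixCoeff` — `L²` smooth coefficients of an admissible `ρE` ⇒ `G`-invariant positive-definite Hermitian form ⇒
  complete reducibility (★ `UnitaryAdmissibleCompleteReducibility`) ⇒ an equivariant section of `p`;
* row 71-D (LH6-p04 (g12)) `isSquareIntegrableModCenter_of_selfExtension` — «the middle term `ρE` is ADMISSIBLE, has the (unitary) central character of `r`, and is `L²` modulo the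
  centre for EVERY Haar measure on `G ⧸ Z`» (Casselman's criterion in `F`-rank one, BOTH directions, ★ `u3SquareIntegrableExponents_holds` + exponent union ★ 71-E
  `JacquetExponentsShortExact` + ★ 71-G `SmoothExtensionAdmissibleCentral`);
* row 71-d (LH6-p03 (g9)) `Representation.memLp_matrixCoeff_of_forall_isSquareIntegrableModCenter` — pull-back `G ⧸ Z ↦ G` of the `L²` domination for a COMPACT centre
  (★ `isCompact_center_Gqs`) — consumed as the HYPOTHESIS `hd` until ★;
* the Haar measure `μG` on `G` chosen inside the proof (Mathlib `Measure.haar`; right-invariant by unimodularity ★ `isMulRightInvariant_cmDatum_local_antidiagOne`; charges open sets),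
  a compact open subgroup (Mathlib `exists_isCompact_openSubgroup`, `G` non-archimedean ★ `nonarchimedeanGroup_Gqs`), admissibility of `r` (★ `isAdmissible_smoothIrrep`).
Place token: `hns` only.  HONEST LABEL: count-neutral dock; K2′-L² = PAYDOWN road, rides when ★-complete (rule 25∕26, LEAD); E1 = PRINT; h413 OPEN; HC_CM is proved only modulo
the 7 printed citations (2 remaining named inputs hLiu418 = stmt-HodgeConjecture-24832, h413 = stmt-HodgeConjecture-24833) until rung 0 closes.

## References
* [Casselman1995] W. Casselman, *Introduction to the theory of admissible representations of `p`-adic reductive groups* (1995), §2.5 Prop. 2.5.3–2.5.4 p. 29, Thm. 4.4.6.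
* [Rogawski1990] J. Rogawski, Ann. of Math. Stud. 123 (1990), §12.2 (2) pp. 173–174 (`π²(ξ)` square-integrable), §12.6 Prop. 12.6.1 p. 188.
* [BernsteinZelevinskyRMS1976] I. N. Bernstein, A. V. Zelevinsky, Russian Math. Surveys 31:3 (1976), 2.39–2.44 pp. 26–28.
-/

set_option autoImplicit false
-- the mandated namespace has the single-problem summit's repeated segment (`HodgeConjecture.HodgeConjecture`)
set_option linter.dupNamespace false

noncomputable section

open NumberField IsDedekindDomain MeasureTheory
open Literature.NumberTheory.Automorphic Literature.NumberTheory.Automorphic.UnitaryGroup Literature.NumberTheory.Rogawski1990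
open Summit.HodgeConjecture.HodgeConjecture.Cruxes.H413

namespace Summit.HodgeConjecture.HodgeConjecture.Cruxes.H413.F0P3cStCharTSHsplitOfL2

variable (L : Type) [Field L] [NumberField L] [IsCMField L] (v : HeightOneSpectrum (𝓞 ↥(maximalRealSubfield L)))

/-- **`hsplit` OF ★ 59-F AT EVERY `L²` CLASS.**  For `G = U(Φ₃)(L⁺_v)` at a NON-SPLIT place, a Haar measure `μZ` on `G ⧸ Z(G)` (Borel quotient; the organ head's own
letters) and an irreducible smooth `r` whose class is square-integrable modulo the centre w.r.t. `μZ` (the organ's `𝔇.IsL2 ⟦r⟧` along `hC03 : 𝔇.μGZ = μZ`): EVERY smooth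
self-extension `0 → r.ρ —i→ ρE —p→ r.ρ → 0` SPLITS — ★ 59-F's `hsplit` binder VERBATIM (:109–111 of `Theorems/F0P3cStCharTSEPNormOneUnr.lean`).  Proof: ★ 71-D gives
`ρE` admissible and `L²` mod centre for every Haar measure on `G ⧸ Z`; a Haar `μG` on `G` (right-invariant by unimodularity ★ `isMulRightInvariant_cmDatum_local_antidiagOne`,
charging open sets), a compact open subgroup (★ `nonarchimedeanGroup_Gqs`) and ★ 71-d (compact centre ★ `isCompact_center_Gqs`) turn this into the three hypotheses of ★ row 70
(F) `Representation.selfExtension_splits_of_memLp_matrixCoeff`.  No print letter: Casselman's criterion is ★ `u3SquareIntegrableExponents_holds`.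
[cite: Casselman1995, §2.5 Prop. 2.5.3–2.5.4 p. 29 and Thm. 4.4.6] [cite: Rogawski1990, §12.2 (2) pp. 173–174] -/
theorem hsplit_of_isSquareIntegrable (hns : ∀ w : PlacesOver L v, IsCMField.complexConj L • w.1 = w.1)
    [MeasurableSpace (Gqs L v ⧸ Subgroup.center (Gqs L v))] [BorelSpace (Gqs L v ⧸ Subgroup.center (Gqs L v))]
    (μZ : Measure (Gqs L v ⧸ Subgroup.center (Gqs L v))) [μZ.IsHaarMeasure]
    (r : SmoothIrrep (Gqs L v)) (hL2 : (IrrClass.mk r).IsSquareIntegrable μZ) :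
    ∀ (E : Type) [AddCommGroup E] [Module ℂ E] (ρE : Representation ℂ (Gqs L v) E), ρE.IsSmooth →
      ∀ (i : r.ρ.IntertwiningMap ρE) (p : ρE.IntertwiningMap r.ρ), Function.Injective i → LinearMap.ker p.toLinearMap = LinearMap.range i.toLinearMap →
        Function.Surjective p → ∃ s : r.ρ.IntertwiningMap ρE, p.comp s = Representation.IntertwiningMap.id r.ρ := by
  intro E _ _ ρE hE i p hi hker hp
  obtain ⟨hadm, -, hL2E⟩ := F0P3cStCharTSSelfExtSquareIntegrable.isSquareIntegrableModCenter_of_selfExtension L v hns μZ r hL2 ρE hE i p hi hker hp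
  -- a Haar measure on `G`, right-invariant by unimodularity, charging open sets
  borelize (Gqs L v)
  set μG : Measure (Gqs L v) := Measure.haar with hμG
  haveI : μG.IsMulRightInvariant := isMulRightInvariant_cmDatum_local_antidiagOne L 3 v μG
  -- a compact open subgroup (`G` non-archimedean)
  haveI : NonarchimedeanGroup (Gqs L v) := F0P3cStCharTSScTracePackage.nonarchimedeanGroup_Gqs L v
  obtain ⟨K₀, hK₀c⟩ := exists_isCompact_openSubgroup (G := Gqs L v)
  -- the `L²` smooth coefficients of `ρE` on `G`
  have hL2' : ∀ φ ∈ ρE.contragredient, ∀ x : E, MemLp (ρE.matrixCoeff φ x) 2 μG := fun φ hφ x =>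
    Representation.memLp_matrixCoeff_of_forall_isSquareIntegrableModCenter (F0P3cStCharTSParField.isCompact_center_Gqs L v hns) μG hE
      hL2E hφ x
  exact Representation.selfExtension_splits_of_memLp_matrixCoeff μG r.ρ ρE r.ρ hadm ⟨(K₀ : Subgroup (Gqs L v)), K₀.isOpen, hK₀c⟩ hL2' i p hi hker hp

end Summit.HodgeConjecture.HodgeConjecture.Cruxes.H413.F0P3cStCharTSHsplitOfL2

end
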